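import Literature.Probability.LatticeModels.CumulantExponentialClosedForm
import Mathlib.Analysis.Normed.Algebra.Exponential
import Mathlib.Analysis.Normed.Ring.InfiniteSum
import Mathlib.RingTheory.PowerSeries.Substitution
import Mathlib.Topology.Algebra.InfiniteSum.Real
import HarnessLib

/-!
# The exponential formula, analytic form: `Σ_k μ_k/k! = exp (Σ_{n≥1} κ_n/n!)` in a Banach algebra

Topic `Literature/Probability/LatticeModels`; the analytic companion of `CumulantExponentialClosedForm.lean`.
There, for a moment sequence `μ : ℕ → C` with `μ 0 = 1` in a commutative `ℚ`-algebra and its cumulants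
`κ = cumulantOf μ`, the exponential generating functions satisfy `egf μ = exp (egfPos κ)` as FORMAL power series.
Here `C = B` is a commutative Banach algebra (with `‖1‖ = 1`) and the series are evaluated at `t = 1`: if `Σ_n ‖κ_n‖/n! < ∞`, then
`Σ_k ‖μ_k‖/k! < ∞` and

`Σ'_k μ_k/k! = NormedSpace.exp (Σ'_{n ≥ 1} κ_n/n!)`   (`tsum_egf_eq_exp_tsum_egfPos_cumulantOf`),

the identity by which the effective potential of the next scale `Σ_n 𝓔ᵀ(V; n)/n!` (Benfatto–Giuliani–
Mastropietro 2006, (2.13); Mastropietro 2008, (2.36)) is a genuine logarithm of `∫P(dψ) e^{V}` as soon as the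
cumulant series converges — with NO analysis beyond absolutely convergent double series: the coefficients of
`exp (F)` are `Σ_{d ≤ n} [F^d]_n/d!`, evaluation at `1` is multiplicative on norm-summable series (Cauchy
product), `‖[F^d]_n‖` is dominated by the coefficients of the powers of the majorant `Σ ‖F_n‖ Xⁿ`, and the
double series is exchanged (its sum is `≤ exp Σ‖F_n‖`).

* `NormSummable`, `ev` (`= Σ'_n [G]_n`), `NormSummable.mul`, `ev_mul`, `NormSummable.pow`, `ev_pow`,
  `norm_coeff_pow_le_coeff_majorant_pow`, `coeff_pow_eq_zero_of_lt`;
* **`ev_exp_subst`** — `NormSummable (exp.subst F)` and `ev (exp.subst F) = NormedSpace.exp (ev F)` for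
  `F(0) = 0`, `F` norm-summable;
* **`tsum_egf_eq_exp_tsum_egfPos_cumulantOf`** — the moment–cumulant form.

Everything is proved; no named fact.

## Sources

D. Ruelle, *Statistical Mechanics: Rigorous Results* (1969), §4.4 (`Ruelle1969`); V. Mastropietro,
*Non-Perturbative Renormalization* (2008), §2.3 (2.35)–(2.36) (`Mastropietro2008`).
-/

noncomputable section

open Finset PowerSeries
open scoped Nat

namespace Literature.Probability.LatticeModels

/-! ### Norm-summable power series and their evaluation at `1` -/

section Ev

variable {B : Type*} [NormedRing B] [CompleteSpace B]

/-- A power series with summable coefficient norms (absolutely convergent at `t = 1`). [folklore] -/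
def NormSummable (G : B⟦X⟧) : Prop := Summable fun n => ‖coeff n G‖

/-- The value at `t = 1`: the sum of the coefficients. [folklore] -/
def ev (G : B⟦X⟧) : B := ∑' n, coeff n G

omit [CompleteSpace B] in
/-- Unfolding `ev`. [folklore] -/
theorem ev_def (G : B⟦X⟧) : ev G = ∑' n, coeff n G := rfl

/-- The coefficients of a norm-summable series are summable. [folklore] -/
theorem NormSummable.summable {G : B⟦X⟧} (hG : NormSummable G) : Summable fun n => coeff n G := hG.of_norm

omit [CompleteSpace B] in
/-- **Products of norm-summable series are norm-summable.** [folklore] -/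
theorem NormSummable.mul {G H : B⟦X⟧} (hG : NormSummable G) (hH : NormSummable H) : NormSummable (G * H) := by
  have h := summable_norm_sum_mul_antidiagonal_of_summable_norm hG hH
  refine (summable_congr fun n => ?_).1 h
  rw [coeff_mul]

/-- **Evaluation at `1` is multiplicative on norm-summable series** (Cauchy product). [folklore] -/
theorem ev_mul {G H : B⟦X⟧} (hG : NormSummable G) (hH : NormSummable H) : ev (G * H) = ev G * ev H := by
  rw [ev, ev, ev, tsum_mul_tsum_eq_tsum_sum_antidiagonal_of_summable_norm hG hH]
  exact tsum_congr fun n => by rw [coeff_mul]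

omit [CompleteSpace B] in
/-- The constant series `1` is norm-summable. [folklore] -/
theorem NormSummable.one : NormSummable (1 : B⟦X⟧) := by
  refine summable_of_ne_finset_zero (s := {0}) fun n hn => ?_
  rw [mem_singleton] at hn
  rw [coeff_one, if_neg hn, norm_zero]

omit [CompleteSpace B] in
/-- `ev 1 = 1`. [folklore] -/
theorem ev_one : ev (1 : B⟦X⟧) = 1 := by
  rw [ev, tsum_eq_single 0 fun n hn => by rw [coeff_one, if_neg hn], coeff_zero_eq_constantCoeff_apply, map_one]

omit [CompleteSpace B] in
/-- Powers of norm-summable series are norm-summable. [folklore] -/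
theorem NormSummable.pow {G : B⟦X⟧} (hG : NormSummable G) : ∀ d : ℕ, NormSummable (G ^ d)
  | 0 => by rw [pow_zero]; exact NormSummable.one
  | d + 1 => by rw [pow_succ]; exact (NormSummable.pow hG d).mul hG

/-- `ev (G^d) = (ev G)^d`. [folklore] -/
theorem ev_pow {G : B⟦X⟧} (hG : NormSummable G) : ∀ d : ℕ, ev (G ^ d) = ev G ^ d
  | 0 => by rw [pow_zero, pow_zero, ev_one]
  | d + 1 => by rw [pow_succ, pow_succ, ev_mul (hG.pow d) hG, ev_pow hG d]

omit [CompleteSpace B] in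
/-- **The majorant**: `‖[G^d]_n‖ ≤ [g^d]_n` for `g = Σ ‖G_n‖ Xⁿ` (in a normed ring with `‖1‖ = 1`). [folklore] -/
theorem norm_coeff_pow_le_coeff_majorant_pow [NormOneClass B] (G : B⟦X⟧) :
    ∀ (d n : ℕ), ‖coeff n (G ^ d)‖ ≤ coeff n ((PowerSeries.mk fun n => ‖coeff n G‖ : ℝ⟦X⟧) ^ d)
  | 0, n => by
    rw [pow_zero, pow_zero, coeff_one, coeff_one]
    split_ifs
    · rw [norm_one]
    · rw [norm_zero]
  | d + 1, n => by
    rw [pow_succ, pow_succ, coeff_mul, coeff_mul]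
    refine (norm_sum_le _ _).trans (sum_le_sum fun p _ => ?_)
    rw [coeff_mk]
    exact (norm_mul_le _ _).trans (mul_le_mul_of_nonneg_right (norm_coeff_pow_le_coeff_majorant_pow G d p.1) (norm_nonneg _))

omit [CompleteSpace B] in
/-- The coefficients of the majorant powers are nonnegative. [folklore] -/
theorem coeff_majorant_pow_nonneg [NormOneClass B] (G : B⟦X⟧) (d n : ℕ) : 0 ≤ coeff n ((PowerSeries.mk fun n => ‖coeff n G‖ : ℝ⟦X⟧) ^ d) :=
  (norm_nonneg _).trans (norm_coeff_pow_le_coeff_majorant_pow G d n)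

omit [CompleteSpace B] in
/-- **A series without constant term has `[F^d]_n = 0` for `n < d`.** [folklore] -/
theorem coeff_pow_eq_zero_of_lt {F : B⟦X⟧} (hF : constantCoeff F = 0) : ∀ {d n : ℕ}, n < d → coeff n (F ^ d) = 0
  | 0, n, h => absurd h (Nat.not_lt_zero _)
  | d + 1, n, h => by
    rw [pow_succ, coeff_mul]
    refine sum_eq_zero fun p hp => ?_
    have hpn := mem_antidiagonal.1 hp
    rcases Nat.eq_zero_or_pos p.2 with h2 | h2
    · rw [h2, coeff_zero_eq_constantCoeff_apply, hF, mul_zero]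
    · rw [coeff_pow_eq_zero_of_lt hF (show p.1 < d by omega), zero_mul]

end Ev

/-! ### `ev (exp ∘ F) = exp (ev F)` -/

section Exp

variable {B : Type*} [NormedCommRing B] [NormOneClass B] [NormedAlgebra ℚ B] [CompleteSpace B]

omit [CompleteSpace B] [NormOneClass B] in
/-- Norms of `ℚ`-multiples by inverse factorials. [folklore] -/
theorem norm_inv_factorial_smul_le (d : ℕ) (x : B) : ‖((d ! : ℚ)⁻¹) • x‖ ≤ (d ! : ℝ)⁻¹ * ‖x‖ := by
  refine (norm_smul_le _ _).trans (le_of_eq ?_)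
  congr 1
  rw [← Rat.norm_cast_real]
  push_cast
  exact Real.norm_of_nonneg (by positivity)

omit [CompleteSpace B] [NormOneClass B] in
/-- **The coefficients of `exp ∘ F`**: `[exp F]_n = Σ_{d ≤ n} [F^d]_n / d!` for `F(0) = 0`. [folklore] -/
theorem coeff_exp_subst (F : B⟦X⟧) (hF : constantCoeff F = 0) (n : ℕ) :
    coeff n ((exp B).subst F) = ∑ d ∈ range (n + 1), ((d ! : ℚ)⁻¹) • coeff n (F ^ d) := by
  have hs : HasSubst F := HasSubst.of_constantCoeff_zero' hF
  rw [coeff_subst' hs, finsum_eq_sum_of_support_subset _ (s := range (n + 1)) fun d hd => ?_]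
  · refine sum_congr rfl fun d _ => ?_
    rw [coeff_exp, smul_eq_mul, one_div, ← Algebra.smul_def]
  · rw [Function.mem_support] at hd
    rw [mem_coe, mem_range]
    by_contra h
    exact hd (by rw [coeff_pow_eq_zero_of_lt hF (by omega), smul_zero])

/-- **`ev (exp ∘ F) = exp (ev F)`**: for a norm-summable `F` without constant term, `exp ∘ F` is norm-summable and
its value at `1` is the exponential, in the Banach algebra, of the value of `F` (exchange of the absolutely
convergent double series `Σ_{d,n} [F^d]_n/d!`, dominated by `exp Σ_n ‖F_n‖`). [folklore] -/
theorem ev_exp_subst (F : B⟦X⟧) (hF : constantCoeff F = 0) (hFs : NormSummable F) :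
    NormSummable ((exp B).subst F) ∧ ev ((exp B).subst F) = NormedSpace.exp (ev F) := by
  -- the double family and its majorant
  set a : ℕ → ℕ → B := fun d n => ((d ! : ℚ)⁻¹) • coeff n (F ^ d) with ha
  set g : ℝ⟦X⟧ := PowerSeries.mk fun n => ‖coeff n F‖ with hg
  set b : ℕ → ℕ → ℝ := fun d n => (d ! : ℝ)⁻¹ * coeff n (g ^ d) with hb
  have hb0 : ∀ d n, 0 ≤ b d n := fun d n => mul_nonneg (by positivity) (coeff_majorant_pow_nonneg F d n)
  have hab : ∀ d n, ‖a d n‖ ≤ b d n := fun d n =>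
    (norm_inv_factorial_smul_le d _).trans (mul_le_mul_of_nonneg_left (norm_coeff_pow_le_coeff_majorant_pow F d n) (by positivity))
  have hgs : NormSummable g := by
    refine (summable_congr fun n => ?_).2 hFs
    rw [hg, coeff_mk, Real.norm_of_nonneg (norm_nonneg _)]
  -- the rows of the majorant sum to the exponential series of `ev g`
  have hbrow : ∀ d, HasSum (b d) ((d ! : ℝ)⁻¹ * ev g ^ d) := fun d => by
    rw [← ev_pow hgs d]
    exact ((hgs.pow d).summable.hasSum).mul_left _
  have hbsum : Summable (Function.uncurry b) := by
    refine (summable_prod_of_nonneg fun p => hb0 p.1 p.2).2 ⟨fun d => (hbrow d).summable, ?_⟩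
    refine (summable_congr fun d => (hbrow d).tsum_eq).2 ?_
    refine (summable_congr fun d => ?_).1 (Real.summable_pow_div_factorial (ev g))
    rw [div_eq_inv_mul]
  have hasum : Summable (Function.uncurry a) := Summable.of_norm_bounded hbsum fun p => hab p.1 p.2
  -- fibres
  have hcol : ∀ n, ∀ d ∉ range (n + 1), a d n = 0 := fun n d hd => by
    rw [mem_range, not_lt] at hd
    show ((d ! : ℚ)⁻¹) • coeff n (F ^ d) = 0
    rw [coeff_pow_eq_zero_of_lt hF (by omega), smul_zero]
  have hcoeff : ∀ n, coeff n ((exp B).subst F) = ∑' d, a d n := fun n => by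
    rw [coeff_exp_subst F hF n, tsum_eq_sum (hcol n)]
  have hbsum' : Summable (Function.uncurry fun n d => b d n) := hbsum.prod_symm
  have hcolnorm : ∀ n, ‖coeff n ((exp B).subst F)‖ ≤ ∑' d, b d n := fun n => by
    rw [hcoeff n]
    have h1 : Summable fun d => ‖a d n‖ := summable_of_ne_finset_zero (s := range (n + 1)) fun d hd => by rw [hcol n d hd, norm_zero]
    exact (norm_tsum_le_tsum_norm h1).trans (Summable.tsum_le_tsum (fun d => hab d n) h1 (hbsum'.prod_factor n))
  constructor
  · exact Summable.of_nonneg_of_le (fun n => norm_nonneg _) hcolnorm hbsum'.prod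
  · calc ev ((exp B).subst F) = ∑' n, ∑' d, a d n := tsum_congr hcoeff
      _ = ∑' d, ∑' n, a d n := hasum.tsum_comm
      _ = ∑' d, ((d ! : ℚ)⁻¹) • ev (F ^ d) := tsum_congr fun d => ((hFs.pow d).summable.tsum_const_smul _)
      _ = ∑' d, ((d ! : ℚ)⁻¹) • ev F ^ d := by simp only [ev_pow hFs]
      _ = NormedSpace.exp (ev F) := by rw [NormedSpace.exp_eq_tsum_rat]

/-! ### The moment–cumulant form -/

/-- **The exponential formula, analytic form**: for a moment sequence `μ` with `μ 0 = 1` in a commutative Banach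
algebra whose cumulant series `Σ_{n≥1} κ_n/n!` converges absolutely, the moment series `Σ_k μ_k/k!` converges
absolutely and `Σ'_k μ_k/k! = exp (Σ'_{n≥1} κ_n/n!)` (Ruelle 1969, §4.4; Mastropietro 2008, (2.36)).
[cite: Mastropietro2008, §2.3 (2.35)-(2.36)] -/
theorem tsum_egf_eq_exp_tsum_egfPos_cumulantOf (μ : ℕ → B) (hμ : μ 0 = 1) (hκ : NormSummable (egfPos (cumulantOf μ))) :
    NormSummable (egf μ) ∧ ev (egf μ) = NormedSpace.exp (ev (egfPos (cumulantOf μ))) := by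
  rw [egf_eq_exp_subst_egfPos_cumulantOf μ hμ]
  exact ev_exp_subst _ (constantCoeff_egfPos _) hκ

end Exp

end Literature.Probability.LatticeModels
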